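import Literature.AlgebraicGeometry.Motives.IntegralModelRestrictScalarsSheets
import HarnessLib

/-!
# Points of a restricted model are PAIRS (sheet, point over the sheet); points of a localised model are points of the global model

Topic `Literature/AlgebraicGeometry/Motives`; namespace `Literature.AlgebraicGeometry.Motives.IntegralModel`.  Plumbing `def`s (`localisePointEquiv`,
`sheetOf`, `overSheet`, `pointOverSheet`, `ofPointOverSheet`, `sheetRingHom`) and theorems; no named fact, no instance, no notation, no `sorry`.
Cell `hodgecm-mathlib`, P6 «MOD programme», sub-desk P6a, GEN layer — organ «B-POINTS» (G1) (LEAD F0P6-plan M-14a (3): «B-POINTS at three levels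
is needed by `stub_RGD` under any Defs wording»), sequel of ★ INT-RES ∕ INT-RES-SHEETS (A-p03 (g28)).  HC_CM is proved only modulo the printed
citations until rung 0 closes; nothing here is about HC.

THE MATHEMATICS ([GortzWedhorn2020] §(4.8)–(4.9) «an `S′`-scheme regarded as an `S`-scheme; `T`-valued points»; [Hartshorne1977] II Thm. 3.3;
[SerreTate1968] §1).  (1) LOCALISATION: for a global model `𝒳` over `𝓞 F` and a test scheme `T` over `𝒪_{F,(w)}`, the `T`-points of the localised
model `𝒳 ⊗ 𝒪_{F,(w)}` ARE the `T`-points of `𝒳` with `T` regarded over `𝓞 F` (adjunction `Over.map ⊣ Over.pullback`, Mathlib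
`Over.mapPullbackAdj`; `localisePointEquiv`, natural in the model morphism and in `T`).  (2) RESTRICTION: for a square `A → K`, `B → L`,
`L = B ⊗_A K` and a model `𝓜` over `B` of an `L`-scheme `Z`, a `T`-point `y` of the restricted model `restrictScalars 𝓜` (total space
`𝓜.total → Spec B → Spec A`) over a test `A`-scheme `T` is THE SAME THING as a pair: its SHEET `sheetOf y := y ≫ str` — a `T`-point of the sheet model
`𝓑` (★ `sheetModel`, ★ `strHom`), i.e. a morphism `T → Spec B` over `Spec A` — and a point `pointOverSheet y` of `𝓜.total` over `Spec B` defined on `T`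
RE-BASED ALONG ITS SHEET (`overSheet`); conversely `ofPointOverSheet`; the two constructions are inverse (`ofPointOverSheet_pointOverSheet`,
`sheetOf_ofPointOverSheet`, `pointOverSheet_ofPointOverSheet_left`).  When `T = Spec k` for an `A`-algebra `k` the sheet is an `A`-algebra map
`sheetRingHom : B →ₐ[A] k` (Mathlib `Spec.preimage`, as in ★ `embOfPoint`) and `overSheet` is `Spec k` over `B` through it (`overSheet_eq_specOver`).
(3) THE THREE LEVELS of the moduli heart (`Ω = \overline{F_w}`, `R = 𝒪_{Ω}`-valuation ring, `κ(R)`): composing (1) and (2) for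
`𝓨 := (restrictScalarsOfIntermediate hinj 𝓜).localise w` reads every `Ω`-, `R`- or `κ(R)`-point of `𝓨` as (sheet `B → Ω ∕ R ∕ κ(R)`, point of `𝓜ᵢ`
over that sheet); the sheet so read agrees with ★ `specialSheet` on the special fibre (`specialSheet_reductionPoint`, ★ `reductionPoint_comp`) and is
compatible with restriction to the generic point and specialisation to the closed point (composition).  This is what lets the `stub_RGD` prover
apply a moduli interpretation «`𝓜ᵢ(T′)` for `B`-schemes `T′`» to the points MH quantifies over.

## References
* [GortzWedhorn2020] U. Görtz, T. Wedhorn, *Algebraic Geometry I* (2nd ed.), §(4.8)–(4.9) (change of base scheme; functor of points).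
* [Hartshorne1977] R. Hartshorne, *Algebraic Geometry*, II Thm. 3.3 (fibre products: universal property).
* [SerreTate1968] J.-P. Serre, J. Tate, *Good reduction of abelian varieties*, Ann. of Math. 88 (1968), §1 (points of models).
-/

set_option autoImplicit false

noncomputable section

set_option backward.isDefEq.respectTransparency false

open CategoryTheory CategoryTheory.Limits AlgebraicGeometry IsDedekindDomain IsDedekindDomain.HeightOneSpectrum
open scoped NumberField nonZeroDivisors
open Literature.NumberTheory.EllipticCurves (genericFibre)
open Literature.NumberTheory.DiophantineGeometry (geomResidueField specialFibreFunctor residueFieldPoints)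
open Literature.NumberTheory.GaloisRepresentations (closureValuationSubring)

namespace Literature.AlgebraicGeometry.Motives.IntegralModel

/-! ## §1 Points of the localised model = points of the global model (adjunction `Over.map ⊣ Over.pullback`) -/

section Localise

variable {F : Type} [Field F] [NumberField F] {X Y : SchemeOver F}

/-- **`T`-points of `𝒳 ⊗ 𝒪_{F,(w)}` over `𝒪_{F,(w)}` = `T`-points of `𝒳` over `𝓞 F`** (`T` regarded over `𝓞 F` through `𝓞 F → 𝒪_{F,(w)}`): the
adjunction `Over.map ⊣ Over.pullback` (Mathlib `Over.mapPullbackAdj`) at the localised model (★ SP-F `localise_total`).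
[cite: Hartshorne1977, II Thm. 3.3] -/
def localisePointEquiv (𝒳 : IntegralModel (𝓞 F) F X) (w : HeightOneSpectrum (𝓞 F)) (T : SchemeOver (valuationSubringAtPrime F w)) :
    (T ⟶ (𝒳.localise w).total) ≃
      ((Over.map (Spec.map (CommRingCat.ofHom (algebraMap (𝓞 F) (valuationSubringAtPrime F w))))).obj T ⟶ 𝒳.total) :=
  ((Over.mapPullbackAdj (Spec.map (CommRingCat.ofHom (algebraMap (𝓞 F) (valuationSubringAtPrime F w))))).homEquiv T 𝒳.total).symm

/-- The underlying map of the global point is the local point followed by the first projection `𝒳 ⊗ 𝒪_(w) → 𝒳`.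
[cite: Hartshorne1977, II Thm. 3.3] -/
theorem localisePointEquiv_left (𝒳 : IntegralModel (𝓞 F) F X) (w : HeightOneSpectrum (𝓞 F)) (T : SchemeOver (valuationSubringAtPrime F w))
    (y : T ⟶ (𝒳.localise w).total) :
    (localisePointEquiv 𝒳 w T y).left =
      y.left ≫ pullback.fst 𝒳.total.hom (Spec.map (CommRingCat.ofHom (algebraMap (𝓞 F) (valuationSubringAtPrime F w)))) := rfl

/-- `localisePointEquiv` is NATURAL IN THE MODEL MORPHISM: for `U : 𝒳 → 𝒴` over `𝓞 F`, the global point of `y ≫ (U ⊗ 𝒪_(w))` is the global point of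
`y` followed by `U`. [cite: GortzWedhorn2020, §(4.8)–(4.9)] -/
theorem localisePointEquiv_comp_localiseMap (𝒳 : IntegralModel (𝓞 F) F X) (𝒴 : IntegralModel (𝓞 F) F Y) (U : 𝒳.total ⟶ 𝒴.total)
    (w : HeightOneSpectrum (𝓞 F)) (T : SchemeOver (valuationSubringAtPrime F w)) (y : T ⟶ (𝒳.localise w).total) :
    localisePointEquiv 𝒴 w T (y ≫ localiseMap 𝒳 𝒴 U w) = localisePointEquiv 𝒳 w T y ≫ U := by
  ext : 1
  simp only [Over.comp_left, localisePointEquiv_left, Category.assoc, localiseMap_eq]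
  erw [baseChange_map_left_comp_fst (R := valuationSubringAtPrime F w) U]

/-- `localisePointEquiv` is NATURAL IN THE TEST SCHEME: pre-composition with `g : T′ → T`. [cite: GortzWedhorn2020, §(4.8)–(4.9)] -/
theorem localisePointEquiv_precomp (𝒳 : IntegralModel (𝓞 F) F X) (w : HeightOneSpectrum (𝓞 F)) {T T' : SchemeOver (valuationSubringAtPrime F w)}
    (g : T' ⟶ T) (y : T ⟶ (𝒳.localise w).total) :
    localisePointEquiv 𝒳 w T' (g ≫ y) =
      (Over.map (Spec.map (CommRingCat.ofHom (algebraMap (𝓞 F) (valuationSubringAtPrime F w))))).map g ≫ localisePointEquiv 𝒳 w T y := by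
  ext : 1
  rw [localisePointEquiv_left, Over.comp_left, Over.comp_left, localisePointEquiv_left, Over.map_map_left, Category.assoc]

end Localise

/-! ## §2 Points of a restricted model = (sheet, point over the sheet) -/

section Restrict

variable {A K B L : Type} [CommRing A] [Field K] [Algebra A K] [CommRing B] [Field L] [Algebra B L]
  [Algebra A B] [Algebra K L] [Algebra A L] [IsScalarTower A B L] [IsScalarTower A K L] [Algebra.IsPushout A B K L]
  {Z : SchemeOver L} (𝓜 : IntegralModel B L Z) {T : SchemeOver A}

/-- **The sheet of a `T`-point of the restricted model**: its image in the sheet model `𝓑` (★ `strHom`), i.e. the morphism `T → Spec B` over `Spec A`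
underlying the point. [cite: GortzWedhorn2020, §(4.8)–(4.9)] -/
abbrev sheetOf (y : T ⟶ (restrictScalars (A := A) (K := K) 𝓜).total) : T ⟶ (sheetModel A K B L).total :=
  y ≫ strHom (A := A) (K := K) 𝓜

/-- The underlying map of the sheet is `y ≫ (𝓜.total → Spec B)`. [cite: GortzWedhorn2020, §(4.8)–(4.9)] -/
theorem sheetOf_left (y : T ⟶ (restrictScalars (A := A) (K := K) 𝓜).total) : (sheetOf 𝓜 y).left = y.left ≫ 𝓜.total.hom := rfl

variable (A K B L) in
/-- **The test scheme RE-BASED ALONG A SHEET**: a `T`-point `s` of the sheet model is a morphism `T → Spec B` over `Spec A`; `overSheet s` is `T`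
regarded as a `B`-scheme through it. [cite: GortzWedhorn2020, §(4.8)–(4.9)] -/
def overSheet {T : SchemeOver A} (s : T ⟶ (sheetModel A K B L).total) : SchemeOver B :=
  Over.mk s.left

/-- `(overSheet s).hom = s.left`. [cite: GortzWedhorn2020, §(4.8)–(4.9)] -/
@[simp] theorem overSheet_hom (s : T ⟶ (sheetModel A K B L).total) : (overSheet A K B L s).hom = s.left := rfl

/-- `(overSheet s).left = T.left`. [cite: GortzWedhorn2020, §(4.8)–(4.9)] -/
theorem overSheet_left (s : T ⟶ (sheetModel A K B L).total) : (overSheet A K B L s).left = T.left := rfl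

/-- Regarding `overSheet s` back over `Spec A` recovers `T`: `s.left ≫ (Spec B → Spec A) = T.hom`. [cite: GortzWedhorn2020, §(4.8)–(4.9)] -/
theorem overSheet_hom_comp (s : T ⟶ (sheetModel A K B L).total) :
    (overSheet A K B L s).hom ≫ Spec.map (CommRingCat.ofHom (algebraMap A B)) = T.hom := by
  have h := Over.w s
  rw [sheetModel_total_hom, Category.id_comp] at h
  exact h

/-- **The point over its sheet**: a `T`-point `y` of the restricted model IS a point of `𝓜.total` over `Spec B`, defined on `T` re-based along the
sheet of `y`. [cite: GortzWedhorn2020, §(4.8)–(4.9)] -/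
def pointOverSheet (y : T ⟶ (restrictScalars (A := A) (K := K) 𝓜).total) : overSheet A K B L (sheetOf 𝓜 y) ⟶ 𝓜.total :=
  Over.homMk y.left rfl

/-- The underlying map of the point over its sheet is that of `y`. [cite: GortzWedhorn2020, §(4.8)–(4.9)] -/
@[simp] theorem pointOverSheet_left (y : T ⟶ (restrictScalars (A := A) (K := K) 𝓜).total) : (pointOverSheet 𝓜 y).left = y.left := rfl

/-- **Conversely**: a sheet `s` (a `T`-point of `𝓑`) and a point `x` of `𝓜.total` over `Spec B` on `T` re-based along `s` give a `T`-point of the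
restricted model. [cite: GortzWedhorn2020, §(4.8)–(4.9)] -/
def ofPointOverSheet (s : T ⟶ (sheetModel A K B L).total) (x : overSheet A K B L s ⟶ 𝓜.total) :
    T ⟶ (restrictScalars (A := A) (K := K) 𝓜).total :=
  Over.homMk x.left (by
    rw [restrictScalars_total_hom, ← Category.assoc, Over.w x]
    exact overSheet_hom_comp s)

/-- The underlying map of `ofPointOverSheet s x` is that of `x`. [cite: GortzWedhorn2020, §(4.8)–(4.9)] -/
@[simp] theorem ofPointOverSheet_left (s : T ⟶ (sheetModel A K B L).total) (x : overSheet A K B L s ⟶ 𝓜.total) :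
    (ofPointOverSheet (A := A) (K := K) 𝓜 s x).left = x.left := rfl

/-- Round trip (1): the sheet of `ofPointOverSheet s x` is `s`. [cite: GortzWedhorn2020, §(4.8)–(4.9)] -/
theorem sheetOf_ofPointOverSheet (s : T ⟶ (sheetModel A K B L).total) (x : overSheet A K B L s ⟶ 𝓜.total) :
    sheetOf 𝓜 (ofPointOverSheet (A := A) (K := K) 𝓜 s x) = s := by
  ext : 1
  rw [sheetOf_left, ofPointOverSheet_left]
  exact Over.w x

/-- Round trip (1′): the underlying map of the point over the sheet of `ofPointOverSheet s x` is that of `x`. [cite: GortzWedhorn2020, §(4.8)–(4.9)] -/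
theorem pointOverSheet_ofPointOverSheet_left (s : T ⟶ (sheetModel A K B L).total) (x : overSheet A K B L s ⟶ 𝓜.total) :
    (pointOverSheet 𝓜 (ofPointOverSheet (A := A) (K := K) 𝓜 s x)).left = x.left := rfl

/-- Round trip (2): a point is recovered from its sheet and its point over the sheet. [cite: GortzWedhorn2020, §(4.8)–(4.9)] -/
theorem ofPointOverSheet_pointOverSheet (y : T ⟶ (restrictScalars (A := A) (K := K) 𝓜).total) :
    ofPointOverSheet (A := A) (K := K) 𝓜 (sheetOf 𝓜 y) (pointOverSheet 𝓜 y) = y := by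
  ext : 1
  rfl

/-- Two points with the same underlying map are equal (hence: same sheet and same point over it). [cite: GortzWedhorn2020, §(4.8)–(4.9)] -/
theorem point_ext {y y' : T ⟶ (restrictScalars (A := A) (K := K) 𝓜).total} (h : y.left = y'.left) : y = y' :=
  Over.OverMorphism.ext h

/-- The sheet is natural in the test scheme: `sheetOf (g ≫ y) = g ≫ sheetOf y`. [cite: GortzWedhorn2020, §(4.8)–(4.9)] -/
theorem sheetOf_precomp {T' : SchemeOver A} (g : T' ⟶ T) (y : T ⟶ (restrictScalars (A := A) (K := K) 𝓜).total) :
    sheetOf 𝓜 (g ≫ y) = g ≫ sheetOf 𝓜 y :=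
  Category.assoc _ _ _

/-! ### Affine test schemes: the sheet as an `A`-algebra map `B → k` -/

variable {k : Type} [CommRing k] [Algebra A k]

/-- **The sheet of a `k`-valued point as a ring map `B →ₐ[A] k`** (`T = Spec k`; Mathlib `Spec.preimage`, as in ★ `embOfPoint`).
[cite: GortzWedhorn2020, §(4.8)–(4.9)] -/
def sheetRingHom (s : specOver A k ⟶ (sheetModel A K B L).total) : B →ₐ[A] k where
  toRingHom := (Spec.preimage (s.left : Spec (.of k) ⟶ Spec (.of B))).hom
  commutes' a := by
    have hw := overSheet_hom_comp (A := A) (K := K) (B := B) (L := L) s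
    rw [overSheet_hom] at hw
    have h1 : Spec.map (CommRingCat.ofHom (algebraMap A B) ≫ Spec.preimage (s.left : Spec (.of k) ⟶ Spec (.of B))) =
        Spec.map (CommRingCat.ofHom (algebraMap A k)) := by
      rw [Spec.map_comp, Spec.map_preimage]
      exact hw
    have h2 := congrArg (fun f : CommRingCat.of A ⟶ CommRingCat.of k => f.hom a) (Spec.map_injective h1)
    simpa using h2

/-- `Spec (sheetRingHom s) = s.left`. [cite: GortzWedhorn2020, §(4.8)–(4.9)] -/
theorem specMap_sheetRingHom (s : specOver A k ⟶ (sheetModel A K B L).total) :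
    Spec.map (CommRingCat.ofHom (sheetRingHom (A := A) (K := K) (B := B) (L := L) s).toRingHom) = s.left := by
  change Spec.map (Spec.preimage _) = _
  rw [Spec.map_preimage]

/-- **`Spec k` re-based along the sheet `s` IS `Spec k` over `B` through `sheetRingHom s`.** [cite: GortzWedhorn2020, §(4.8)–(4.9)] -/
theorem overSheet_eq_specOver (s : specOver A k ⟶ (sheetModel A K B L).total) :
    overSheet A K B L s = (letI := (sheetRingHom (A := A) (K := K) (B := B) (L := L) s).toRingHom.toAlgebra; specOver B k) := by
  letI := (sheetRingHom (A := A) (K := K) (B := B) (L := L) s).toRingHom.toAlgebra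
  change Over.mk s.left = Over.mk (Spec.map (CommRingCat.ofHom (sheetRingHom (A := A) (K := K) (B := B) (L := L) s).toRingHom))
  rw [specMap_sheetRingHom]

/-- Two sheets on `Spec k` with the same ring map are equal. [cite: GortzWedhorn2020, §(4.8)–(4.9)] -/
theorem sheet_eq_of_sheetRingHom_eq {s s' : specOver A k ⟶ (sheetModel A K B L).total}
    (h : sheetRingHom (A := A) (K := K) (B := B) (L := L) s = sheetRingHom (A := A) (K := K) (B := B) (L := L) s') : s = s' := by
  ext : 1
  rw [← specMap_sheetRingHom s, ← specMap_sheetRingHom s', h]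

end Restrict

/-! ## §3 Number fields: the three levels of the moduli heart, read as (sheet, point of `𝓜ᵢ` over the sheet) -/

section NumberField

variable {F L : Type} [Field F] [NumberField F] [Field L] [NumberField L] [Algebra F L]
  {B : Type} [CommRing B] [Algebra (𝓞 L) B] [Algebra B L] [IsScalarTower (𝓞 L) B L]
  [Algebra (𝓞 F) B] [IsScalarTower (𝓞 F) B L]
  (hinj : Function.Injective (algebraMap B L)) {Z : SchemeOver L} (w : HeightOneSpectrum (𝓞 F))

/-- **The sheet of a `T`-point of the LOCALISED restricted model** (`T` any `𝒪_{F,(w)}`-scheme: `Spec Ω`, `Spec R`, `Spec κ(R)` in the heart), as a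
`T`-point of the global sheet model over `𝓞 F`: localise-adjunction then ★ `strHom`. [cite: SerreTate1968, §1] -/
def sheetAt (𝓜 : IntegralModel B L Z) (T : SchemeOver (valuationSubringAtPrime F w))
    (y : T ⟶ ((restrictScalarsOfIntermediate (F := F) hinj 𝓜).localise w).total) :
    (Over.map (Spec.map (CommRingCat.ofHom (algebraMap (𝓞 F) (valuationSubringAtPrime F w))))).obj T ⟶ (sheetModelOf (F := F) hinj).total :=
  haveI := isPushout_of_injective (F := F) hinj
  sheetOf 𝓜 (localisePointEquiv (restrictScalarsOfIntermediate (F := F) hinj 𝓜) w T y)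

/-- **The sheet at any level is the localise-adjoint of `y ≫ (str ⊗ 𝒪_(w))`** — so it is the SAME sheet the special fibre reads through ★
`specialSheet` (★ `localiseMap` of ★ `strHomOf`; naturality `localisePointEquiv_comp_localiseMap`). [cite: SerreTate1968, §1] -/
theorem sheetAt_eq (𝓜 : IntegralModel B L Z) (T : SchemeOver (valuationSubringAtPrime F w))
    (y : T ⟶ ((restrictScalarsOfIntermediate (F := F) hinj 𝓜).localise w).total) :
    sheetAt hinj w 𝓜 T y = localisePointEquiv (sheetModelOf (F := F) hinj) w T (y ≫ localiseMap _ _ (strHomOf (F := F) hinj 𝓜) w) :=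
  (localisePointEquiv_comp_localiseMap _ _ (strHomOf (F := F) hinj 𝓜) w T y).symm

/-- **The point of `𝓜ᵢ` over its sheet**, at any level. [cite: SerreTate1968, §1] -/
def pointAt (𝓜 : IntegralModel B L Z) (T : SchemeOver (valuationSubringAtPrime F w))
    (y : T ⟶ ((restrictScalarsOfIntermediate (F := F) hinj 𝓜).localise w).total) :
    haveI := isPushout_of_injective (F := F) hinj
    overSheet (𝓞 F) F B L (sheetAt hinj w 𝓜 T y) ⟶ 𝓜.total :=
  haveI := isPushout_of_injective (F := F) hinj
  pointOverSheet 𝓜 (localisePointEquiv (restrictScalarsOfIntermediate (F := F) hinj 𝓜) w T y)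

/-- The underlying map of the point over its sheet: the local point followed by the projection `𝓨 → 𝓜ᵢ.total`. [cite: SerreTate1968, §1] -/
theorem pointAt_left (𝓜 : IntegralModel B L Z) (T : SchemeOver (valuationSubringAtPrime F w))
    (y : T ⟶ ((restrictScalarsOfIntermediate (F := F) hinj 𝓜).localise w).total) :
    (pointAt hinj w 𝓜 T y).left =
      y.left ≫ pullback.fst (restrictScalarsOfIntermediate (F := F) hinj 𝓜).total.hom
        (Spec.map (CommRingCat.ofHom (algebraMap (𝓞 F) (valuationSubringAtPrime F w)))) := rfl

/-- Sheets are natural in the test scheme (restriction to the generic point, specialisation to the closed point): `sheetAt (g ≫ y) = g♯ ≫ sheetAt y`.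
[cite: SerreTate1968, §1] -/
theorem sheetAt_precomp (𝓜 : IntegralModel B L Z) {T T' : SchemeOver (valuationSubringAtPrime F w)} (g : T' ⟶ T)
    (y : T ⟶ ((restrictScalarsOfIntermediate (F := F) hinj 𝓜).localise w).total) :
    sheetAt hinj w 𝓜 T' (g ≫ y) =
      (Over.map (Spec.map (CommRingCat.ofHom (algebraMap (𝓞 F) (valuationSubringAtPrime F w))))).map g ≫ sheetAt hinj w 𝓜 T y := by
  haveI := isPushout_of_injective (F := F) hinj
  change sheetOf 𝓜 _ = _ ≫ sheetOf 𝓜 _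
  rw [localisePointEquiv_precomp, sheetOf_precomp]

/-- **Consistency with ★ `specialSheet` on the special fibre**: for a `κ(R)`-point `yκ` of the localised restricted model, the special point
`reductionPoint yκ` has special sheet `reductionPoint (yκ ≫ (str ⊗ 𝒪_(w)))` (★ `reductionPoint_comp`), whose localise-adjoint is `sheetAt yκ`
(`sheetAt_eq`). [cite: SerreTate1968, §1] -/
theorem specialSheet_reductionPoint (𝓜 : IntegralModel B L Z)
    (yκ : residueFieldPoints ((restrictScalarsOfIntermediate (F := F) hinj 𝓜).localise w).total) :
    specialSheet hinj w 𝓜 (((restrictScalarsOfIntermediate (F := F) hinj 𝓜).localise w).reductionPoint yκ) =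
      ((sheetModelOf (F := F) hinj).localise w).reductionPoint (yκ ≫ localiseMap _ _ (strHomOf (F := F) hinj 𝓜) w) :=
  (reductionPoint_comp _ _ (localiseMap _ _ (strHomOf (F := F) hinj 𝓜) w) yκ).symm

/-- **Consistency with ★ `genericSheet` at the generic level**: for an `Ω`-point `x` of `Z ∕ F` read in the localised restricted model through ★
`modelPointsEquiv⁻¹`, the model point `𝓑.modelPointsEquiv⁻¹ (genericSheet x)` of the sheet model is `𝓨.modelPointsEquiv⁻¹ x ≫ (str ⊗ 𝒪_(w))`
(★ `modelPointsEquiv_symm_map` at the localised structure morphism) — hence `sheetAt (𝓨.modelPointsEquiv⁻¹ x)` is its localise-adjoint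
(`sheetAt_eq`). [cite: SerreTate1968, §1] -/
theorem modelPointsEquiv_symm_genericSheet (𝓜 : IntegralModel B L Z)
    (x : AlgPoints (SchemeOver.restrictScalars F Z) (AlgebraicClosure (w.adicCompletion F))) :
    ((sheetModelOf (F := F) hinj).localise w).modelPointsEquiv.symm (genericSheet x) =
      ((restrictScalarsOfIntermediate (F := F) hinj 𝓜).localise w).modelPointsEquiv.symm x ≫
        localiseMap _ _ (strHomOf (F := F) hinj 𝓜) w :=
  modelPointsEquiv_symm_map _ _ (localiseMap _ _ (strHomOf (F := F) hinj 𝓜) w) (toSheetScheme F Z)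
    (genericFibre_map_localiseMap_strHomOf hinj w 𝓜) x

/-- The generic-level sheet of `𝓨.modelPointsEquiv⁻¹ x` is the localise-adjoint of `𝓑.modelPointsEquiv⁻¹ (genericSheet x)`. [cite: SerreTate1968, §1] -/
theorem sheetAt_modelPointsEquiv_symm (𝓜 : IntegralModel B L Z)
    (x : AlgPoints (SchemeOver.restrictScalars F Z) (AlgebraicClosure (w.adicCompletion F))) :
    sheetAt hinj w 𝓜 _ (((restrictScalarsOfIntermediate (F := F) hinj 𝓜).localise w).modelPointsEquiv.symm x) =
      localisePointEquiv (sheetModelOf (F := F) hinj) w _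
        (((sheetModelOf (F := F) hinj).localise w).modelPointsEquiv.symm (genericSheet x)) := by
  rw [sheetAt_eq, modelPointsEquiv_symm_genericSheet]

end NumberField

end Literature.AlgebraicGeometry.Motives.IntegralModel
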